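import Summits.HodgeConjecture.CorCM.Census.CentralSquaresOrderFourLaw
import Summits.HodgeConjecture.CorCM.Census.CentralSquaresDihedralM2

/-!
# The square-central class, XXXII: the dihedral quotient rows WITHOUT an involution over a reflection — `ℤ/4 ⋊ ℤ/4`

COR-CM (cell `pub-hodgecm2`), count-neutral kernel combinatorics by the binder seat b09 (gen 46; lane SQUARE-CENTRAL CLASS, part XXXII), the instance of part XXXIʼs
ORDER-`4` FRAME LAW, on parts IX/X/XI/XXII (`dihedral_*`, `isCMF_comap`, `card_filter_comap`, `exists_ker_involution`) BY NAME, plus three more `decide`s on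
`DihedralGroup 4`.  Theorems only: no definition, no certificate, no named fact, no `sorry`.  HONEST FRAMING: `HC_CM` is NOT proved, here or anywhere in the
tree; nothing here is a period or a headline.

THE LAW (`isLeast_card_gfaces_generate_of_dihedral_quotient_four`).  `G` finite, `c` a central involution, `π : G ↠ D₄` with `π c = r²` and `|ker π| = 2`, a lift
`q` of the reflection `s` and a lift `g₁` of the reflection `sr`, NEITHER an involution (so `q² = g₁² = z`, the kernel involution): **`μ(G, c) = φ₂(G, c)`**.  With
part XXII (an involution over `s`) this settles every `2`-group with a `D₄` quotient of kernel order `2` up to the choice of the reflection classes; the rows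
`ℤ/4 ⋊ ℤ/4` with `c = a²` and with `c = a²y²` (`π` = reduction mod `y²`; every reflection lift has square `y²`) are instances — the last dihedral-quotient rows
of order `16` (design note `CENTRAL-SQUARES-M2.md` §5–6; `μ = φ₂ = β − 2 = 18` numerically).

THE DATUM.  `T₀ = π⁻¹{1, r, s, sr}`, `Q = q` (`T₀·q⁻¹ = T₁`, `T₁·q⁻¹ = T₀·z⁻¹ = T₀`), `T = π⁻¹(r) = {ρ, ρz}` with `ρ = c·g₁·q⁻¹`, `A = π⁻¹(s) = {q, qz}`,
`𝓗 ∖ T = π⁻¹(sr) = {g₁, g₁z}` (`h = g₁`, `h'' = g₁z`), `𝓗ᶜ ∖ A = ker π = {1, z}` (`κ₁ = h·g₁⁻¹ = 1`, `κ₂ = z`), `a₁ = qz`, `a₂ = q`; the designated type is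
`Φ = π⁻¹{1, r³, sr, sr²}`; the two tie blocks are distinct because a base change carrying `Φ^{(q)}` to `Φ^{(g₁)}` would have `π`-value `r³` or `r`, and then
`ρ` resp. `1` witnesses the difference.

## References
* [Pohlmann1968] H. Pohlmann, Algebraic cycles on abelian varieties of complex multiplication type, Ann. of Math. 88 (1968), Thm 1.
* [Milne1999] J. S. Milne, Lefschetz motives and the Tate conjecture, Compositio Math. 117 (1999), Prop. 2.1, p. 54.
-/

namespace Summit.HodgeConjecture.CorCM.Census.CentralSquares

open Finset DihedralGroup
open Summit.HodgeConjecture.CorCM.Prior.AllgGroup.RfwfAllgGroup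
open Summit.HodgeConjecture.CorCM.Census.BlockParity
open Summit.HodgeConjecture.CorCM.Census.Coinvariant
open Summit.HodgeConjecture.CorCM.Census.TwistGeneration
open Summit.HodgeConjecture.CorCM.Census.BaseBlock
open Summit.HodgeConjecture.CorCM.Census.CoverClosure

noncomputable section

variable {G : Type*} [Group G] [Fintype G] [DecidableEq G]

/-! ## §1 Three more facts about `D₄` -/

/-- The lift of `sr` carries `T₁ = T₀·s⁻¹` to `T̄₁`: `x·(sr·s) ∈ X₀ ↔ x·(r²·s) ∈ X₀`. [folklore] -/
theorem dihedral_sr_T₁ : ∀ x : DihedralGroup 4,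
    x * (sr 1 * sr 0) ∈ ({r 0, r 1, sr 0, sr 1} : Finset (DihedralGroup 4)) ↔
      x * (r 2 * sr 0) ∈ ({r 0, r 1, sr 0, sr 1} : Finset (DihedralGroup 4)) := by decide

/-- The designated type is `π⁻¹{1, r³, sr, sr²}`: inside `X₀` its complement is `{r, s}`, outside `X₀` it is `r²·{r, s}`. [folklore] -/
theorem dihedral_Phi : ∀ x : DihedralGroup 4,
    (x ∈ ({r 0, r 1, sr 0, sr 1} : Finset (DihedralGroup 4)) →
      (¬ (x = r 1 ∨ x = sr 0) ↔ x ∈ ({r 0, r 3, sr 1, sr 2} : Finset (DihedralGroup 4)))) ∧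
    (x ∉ ({r 0, r 1, sr 0, sr 1} : Finset (DihedralGroup 4)) →
      ((r 2 * x = r 1 ∨ r 2 * x = sr 0) ↔ x ∈ ({r 0, r 3, sr 1, sr 2} : Finset (DihedralGroup 4)))) := by decide

/-- `{1, r³, sr, sr²}` is stable under right multiplication by `sr`. [folklore] -/
theorem dihedral_Phi_stab : ∀ x : DihedralGroup 4,
    x * sr 1 ∈ ({r 0, r 3, sr 1, sr 2} : Finset (DihedralGroup 4)) ↔ x ∈ ({r 0, r 3, sr 1, sr 2} : Finset (DihedralGroup 4)) := by decide

/-! ## §2 The law -/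

/-- **THE `m = 2` DIHEDRAL LAW WITHOUT INVOLUTIVE REFLECTION LIFTS.**  `G` a finite group, `c` a central involution, `π : G →* D₄` surjective with
`π c = r²` and `|ker π| = 2`, `q` over the reflection `s` and `g₁` over the reflection `sr` with `q² ≠ 1`, `g₁² ≠ 1`: **`μ(G, c) = φ₂(G, c)`**. [folklore] -/
theorem isLeast_card_gfaces_generate_of_dihedral_quotient_four {c : G} (hc2 : c * c = 1) (hcen : ∀ x : G, x * c = c * x)
    (π : G →* DihedralGroup 4) (hπ : Function.Surjective π) (hπc : π c = r 2) (hker : Nat.card π.ker = 2)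
    (q : G) (hπq : π q = sr 0) (hqq : q * q ≠ 1) (g₁ : G) (hπg₁ : π g₁ = sr 1) (hgg : g₁ * g₁ ≠ 1) :
    IsLeast {n : ℕ | ∃ S : Finset (CMF G c →₀ ℤ), (↑S ⊆ gfaceSet G c hc2) ∧ S.card = n ∧
      hodgeSpan c hc2 ≤ Submodule.span ℤ (pairSet c) ⊔ Submodule.span ℤ (translates c S)} (fibreTwo c hc2) := by
  classical
  have hc1 : c ≠ 1 := by
    intro h; rw [h, map_one] at hπc; exact absurd hπc (by decide)
  -- the `2`-group
  have hG : IsPGroup 2 G := by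
    refine IsPGroup.of_card (n := 4) ?_
    have h := card_filter_comap π hπ (univ : Finset (DihedralGroup 4))
    rw [filter_true_of_mem (fun g _ => mem_univ (π g)), card_univ, card_univ, hker] at h
    rw [Nat.card_eq_fintype_card, h]; rfl
  -- the kernel involution; the reflection lifts square to it
  obtain ⟨z, hz1, hπz, hz2, hzc, hkz⟩ := exists_ker_involution π hker
  have hzc' : z ≠ c := by intro h; rw [h, hπc] at hπz; exact absurd hπz (by decide)
  have hq2 : q * q = z := (hkz (q * q) (by rw [map_mul, hπq]; decide)).resolve_left hqq
  have hg2 : g₁ * g₁ = z := (hkz (g₁ * g₁) (by rw [map_mul, hπg₁]; decide)).resolve_left hgg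
  have hqinv : q⁻¹ = q * z := inv_eq_of_mul_eq_one_right (by rw [← mul_assoc, hq2, hz2])
  have hg₁inv : g₁⁻¹ = g₁ * z := inv_eq_of_mul_eq_one_right (by rw [← mul_assoc, hg2, hz2])
  have hcinv : c⁻¹ = c := inv_eq_of_mul_eq_one_right hc2
  -- the datum
  set X₀ : Finset (DihedralGroup 4) := {r 0, r 1, sr 0, sr 1} with hX₀
  let T₀ : CMF G c := ⟨univ.filter fun g : G => π g ∈ X₀, isCMF_comap π hπc⟩
  let T₁ : CMF G c := rt c q T₀
  have hT₀mem : ∀ P : G, P ∈ T₀.1 ↔ π P ∈ X₀ := fun P => by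
    change P ∈ univ.filter (fun g : G => π g ∈ X₀) ↔ _; rw [mem_filter]; simp only [mem_univ, true_and]
  have hrtmem : ∀ (R P : G), P ∈ (rt c R T₀).1 ↔ π P * π R ∈ X₀ := fun R P => by rw [mem_rt, hT₀mem, map_mul]
  have hT₁mem : ∀ P : G, P ∈ T₁.1 ↔ π P * sr 0 ∈ X₀ := fun P => by
    change P ∈ (rt c q T₀).1 ↔ _; rw [hrtmem, hπq]
  have hHset : T₀.1 \ T₁.1 = univ.filter fun g : G => π g ∈ ({r 1, sr 1} : Finset (DihedralGroup 4)) := by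
    ext P; rw [mem_sdiff, hT₀mem, hT₁mem, mem_filter]; simp only [mem_univ, true_and]; exact dihedral_H (π P)
  have hHmem : ∀ P : G, P ∈ T₀.1 \ T₁.1 ↔ π P ∈ ({r 1, sr 1} : Finset (DihedralGroup 4)) := fun P => by
    rw [hHset, mem_filter]; simp only [mem_univ, true_and]
  have hHcmem : ∀ P : G, P ∈ T₀.1 ∩ T₁.1 ↔ π P ∈ ({r 0, sr 0} : Finset (DihedralGroup 4)) := fun P => by
    rw [mem_inter, hT₀mem, hT₁mem]; exact dihedral_Hc (π P)
  have hplace : ∀ t t' : G, (t' = t * q ∨ t' = c * (t * q)) → (π t' = π t * sr 0 ∨ π t' = r 2 * (π t * sr 0)) := by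
    intro t t' h
    rcases h with h | h
    · left; rw [h, map_mul, hπq]
    · right; rw [h, map_mul, map_mul, hπc, hπq]
  have hbase : ∀ R : G, rt c R T₀ = T₀ ∨ rt c R T₀ = rt c c T₀ ∨ rt c R T₀ = T₁ ∨ rt c R T₀ = rt c c T₁ := by
    intro R
    have hrr : ∀ P : G, P ∈ (rt c c T₀).1 ↔ π P * r 2 ∈ X₀ := fun P => by rw [hrtmem, hπc]
    have hrT₁ : ∀ P : G, P ∈ (rt c c T₁).1 ↔ π P * (r 2 * sr 0) ∈ X₀ := fun P => by
      change P ∈ (rt c c (rt c q T₀)).1 ↔ _; rw [← rt_mul, hrtmem, map_mul, hπc, hπq]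
    rcases dihedral_base (π R) with h | h | h | h
    · exact Or.inl (Subtype.ext (Finset.ext fun P => by rw [hrtmem, hT₀mem]; exact h (π P)))
    · exact Or.inr (Or.inl (Subtype.ext (Finset.ext fun P => by rw [hrtmem, hrr]; exact h (π P))))
    · exact Or.inr (Or.inr (Or.inl (Subtype.ext (Finset.ext fun P => by rw [hrtmem, hT₁mem]; exact h (π P)))))
    · exact Or.inr (Or.inr (Or.inr (Subtype.ext (Finset.ext fun P => by rw [hrtmem, hrT₁]; exact h (π P)))))
  have hn : T₀.1.card = 4 * 2 := by
    change (univ.filter fun g : G => π g ∈ X₀).card = 4 * 2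
    rw [card_filter_comap π hπ X₀, hker]; rfl
  have hH : (T₀.1 \ T₁.1).card = 2 * 2 := by rw [hHset, card_filter_comap π hπ, hker]; rfl
  have hσH : ∀ t ∈ T₀.1, ∀ t' ∈ T₀.1, (t' = t * q ∨ t' = c * (t * q)) → (t ∈ T₀.1 \ T₁.1 ↔ t' ∈ T₀.1 \ T₁.1) := by
    intro t ht t' ht' h
    rw [hT₀mem] at ht ht'
    rw [hHmem, hHmem]
    exact dihedral_sigma_H (π t) (π t') ht ht' (hplace t t' h)
  have hQ₁ : rt c q T₁ = T₀ := by
    apply Subtype.ext; ext P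
    change P ∈ (rt c q (rt c q T₀)).1 ↔ P ∈ T₀.1
    rw [← rt_mul, hq2, hrtmem, hπz, mul_one, hT₀mem]
  -- fibres of `π` as two-element sets
  have hfib : ∀ (x : G) (d : DihedralGroup 4), π x = d → ∀ v : G, v ∈ ({x, x * z} : Finset G) ↔ π v = d := by
    intro x d hx v; rw [mem_insert, mem_singleton]
    constructor
    · rintro (rfl | rfl)
      · exact hx
      · rw [map_mul, hx, hπz, mul_one]
    · intro hv
      rcases hkz (x⁻¹ * v) (by rw [map_mul, map_inv, hx, hv, inv_mul_cancel]) with h | h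
      · left; rw [← mul_inv_cancel_left x v, h, mul_one]
      · right; rw [← mul_inv_cancel_left x v, h]
  have hne_z : ∀ x : G, x ≠ x * z := fun x h => hz1 (left_eq_mul.mp h)
  -- the transversal `T = π⁻¹(r) = {ρ, ρz}`, `ρ = c·g₁·q⁻¹`
  set ρ : G := c * g₁ * q⁻¹ with hρdef
  have hρ : π ρ = r 1 := by rw [hρdef, map_mul, map_mul, map_inv, hπc, hπg₁, hπq]; decide
  have hTiff := hfib ρ (r 1) hρ
  have hTH : ({ρ, ρ * z} : Finset G) ⊆ T₀.1 \ T₁.1 := by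
    intro v hv; rw [hHmem, (hTiff v).mp hv]; decide
  have hT : ∀ t ∈ T₀.1 \ T₁.1, ∀ t' ∈ T₀.1, (t' = t * q ∨ t' = c * (t * q)) → (t ∈ ({ρ, ρ * z} : Finset G) ↔ t' ∉ ({ρ, ρ * z} : Finset G)) := by
    intro t ht t' ht' h
    rw [hHmem] at ht
    rw [hT₀mem] at ht'
    have htX : π t ∈ X₀ := dihedral_sub.1 (π t) ht
    obtain ⟨h2, h3, -, -⟩ := dihedral_sigma_val (π t) (π t') htX ht' (hplace t t' h)
    rw [hTiff, hTiff]
    have ht2 : π t = r 1 ∨ π t = sr 1 := by rwa [mem_insert, mem_singleton] at ht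
    constructor
    · intro e; rw [h2.mp e]; decide
    · intro hne'
      rcases ht2 with e | e
      · exact e
      · exact absurd (h3.mp e) hne'
  -- the transversal `A = π⁻¹(s) = {q, qz}`
  have hAiff := hfib q (sr 0) hπq
  have hA : ({q, q * z} : Finset G) ⊆ T₀.1 ∩ T₁.1 := by
    intro v hv; rw [hHcmem, (hAiff v).mp hv]; decide
  have hAtr : ∀ v ∈ T₀.1 ∩ T₁.1, ∀ v' ∈ T₀.1, (v' = v * q ∨ v' = c * (v * q)) →
      (v ∈ ({q, q * z} : Finset G) ↔ v' ∉ ({q, q * z} : Finset G)) := by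
    intro v hv v' hv' h
    rw [hHcmem] at hv
    have hvX : π v ∈ X₀ := dihedral_sub.2 (π v) hv
    have hv'c : π v' ∈ ({r 0, sr 0} : Finset (DihedralGroup 4)) := by
      have hside := dihedral_sigma_H (π v) (π v') hvX ((hT₀mem v').mp hv') (hplace v v' h)
      have hvH : π v ∉ ({r 1, sr 1} : Finset (DihedralGroup 4)) := by
        rw [mem_insert, mem_singleton] at hv ⊢; rcases hv with e | e <;> rw [e] <;> decide
      have hv'H : π v' ∉ ({r 1, sr 1} : Finset (DihedralGroup 4)) := fun h' => hvH (hside.mpr h')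
      have h0 := (dihedral_Hc (π v')).mp
      rw [← hHcmem, mem_inter, hT₀mem, hT₁mem]
      refine ⟨(hT₀mem v').mp hv', ?_⟩
      by_contra h1
      exact hv'H ((dihedral_H (π v')).mp ⟨(hT₀mem v').mp hv', h1⟩)
    rw [hAiff, hAiff]
    exact dihedral_sigma_sr0 (π v) (π v') hv hv'c (hplace v v' h)
  -- the designated type `Φ = π⁻¹{1, r³, sr, sr²}`
  have hDsub : ({ρ, ρ * z} : Finset G) ∪ {q, q * z} ⊆ T₀.1 :=
    union_subset (hTH.trans sdiff_subset) (hA.trans inter_subset_left)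
  obtain ⟨Φ, hΦ⟩ := exists_type_of_dev c hc2 T₀ _ hDsub
  have hΦmem : ∀ P : G, P ∈ Φ.1 ↔ π P ∈ ({r 0, r 3, sr 1, sr 2} : Finset (DihedralGroup 4)) := by
    intro P
    by_cases hP0 : P ∈ T₀.1
    · have e : P ∈ Φ.1 ↔ P ∉ T₀.1 \ Φ.1 := by rw [mem_sdiff]; tauto
      rw [e, hΦ, mem_union, hTiff, hAiff]
      rw [hT₀mem] at hP0
      exact (dihedral_Phi (π P)).1 hP0
    · have hcP : c * P ∈ T₀.1 := by by_contra h'; exact hP0 ((T₀.2 P).mpr h')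
      have e : P ∈ Φ.1 ↔ c * P ∈ T₀.1 \ Φ.1 := by rw [mem_sdiff, Φ.2 P]; tauto
      rw [e, hΦ, mem_union, hTiff, hAiff, map_mul, hπc]
      rw [hT₀mem] at hP0
      exact (dihedral_Phi (π P)).2 hP0
  -- the lift `g₁` of `sr`
  have hg₁T₀ : rt c g₁ T₀ = T₀ := by
    apply Subtype.ext; ext P; rw [hrtmem, hT₀mem, hπg₁]; exact dihedral_stab_sr (π P)
  have hg₁T₁ : rt c g₁ T₁ = rt c c T₁ := by
    apply Subtype.ext; ext P
    change P ∈ (rt c g₁ (rt c q T₀)).1 ↔ P ∈ (rt c c (rt c q T₀)).1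
    rw [← rt_mul, ← rt_mul, hrtmem, hrtmem, map_mul, map_mul, hπg₁, hπq, hπc]
    exact dihedral_sr_T₁ (π P)
  have hgΦ : rt c g₁ Φ = Φ := by
    apply Subtype.ext; ext P; rw [mem_rt, hΦmem, hΦmem, map_mul, hπg₁]; exact dihedral_Phi_stab (π P)
  -- `𝓗 ∖ T = π⁻¹(sr) = {g₁, g₁z}`, `𝓗ᶜ ∖ A = ker π = {1, z}`
  have hGiff := hfib g₁ (sr 1) hπg₁
  have hHe : (T₀.1 \ T₁.1) \ {ρ, ρ * z} = {g₁, g₁ * z} := by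
    ext x
    rw [mem_sdiff, hHmem, hTiff, hGiff, mem_insert, mem_singleton]
    constructor
    · rintro ⟨h1 | h1, h2⟩
      · exact absurd h1 h2
      · exact h1
    · intro h1; refine ⟨Or.inr h1, ?_⟩; rw [h1]; decide
  have hKiff := hfib 1 1 (map_one π)
  rw [one_mul] at hKiff
  have hAce : (T₀.1 ∩ T₁.1) \ {q, q * z} = {g₁ * g₁⁻¹, z} := by
    rw [mul_inv_cancel]
    ext x
    rw [mem_sdiff, hHcmem, hAiff, hKiff, mem_insert, mem_singleton]
    constructor
    · rintro ⟨h1 | h1, h2⟩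
      · rw [h1]; decide
      · exact absurd h1 h2
    · intro h1; rw [h1]; decide
  -- the place relations
  have hzq' : z * q⁻¹ = q := by rw [hqinv, ← mul_assoc, ← hzc q, mul_assoc, hz2, mul_one]
  have hζh : g₁ * g₁⁻¹ * g₁⁻¹ = g₁ * z ∨ g₁ * g₁⁻¹ * g₁⁻¹ = c * (g₁ * z) := Or.inl (by rw [mul_inv_cancel, one_mul, hg₁inv])
  have hζκ : g₁ * g₁⁻¹ * g₁⁻¹ * g₁⁻¹ = z ∨ g₁ * g₁⁻¹ * g₁⁻¹ * g₁⁻¹ = c * z := Or.inl (by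
    rw [mul_inv_cancel, one_mul, hg₁inv, mul_assoc, ← mul_assoc z g₁ z, ← hzc g₁, mul_assoc, hz2, mul_one, hg2])
  have hσh : g₁ * q⁻¹ = ρ ∨ g₁ * q⁻¹ = c * ρ := Or.inr (by rw [hρdef, ← mul_assoc, ← mul_assoc, hc2, one_mul])
  have hσh'' : g₁ * z * q⁻¹ = ρ * z ∨ g₁ * z * q⁻¹ = c * (ρ * z) := Or.inr (by
    rw [hρdef, ← mul_assoc c, ← mul_assoc, ← mul_assoc, hc2, one_mul, mul_assoc g₁ z, ← hzc q⁻¹, ← mul_assoc])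
  have hσκ₁ : g₁ * g₁⁻¹ * q⁻¹ = q * z ∨ g₁ * g₁⁻¹ * q⁻¹ = c * (q * z) := Or.inl (by rw [mul_inv_cancel, one_mul, hqinv])
  have hσκ₂ : z * q⁻¹ = q ∨ z * q⁻¹ = c * q := Or.inl hzq'
  have ha₁A : q * z ∈ ({q, q * z} : Finset G) := mem_insert_of_mem (mem_singleton_self _)
  have ha₂A : q ∈ ({q, q * z} : Finset G) := mem_insert_self _ _
  -- the two tie blocks are distinct
  have hB : ∀ g : G, rt c g (oflipCM c hc2 q Φ) ≠ oflipCM c hc2 g₁ Φ := by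
    intro g E
    have hmemq : ∀ y : G, y ∈ (oflipCM c hc2 q Φ).1 ↔ ¬ (π y ∈ ({r 0, r 3, sr 1, sr 2} : Finset (DihedralGroup 4)) ↔ (y = q ∨ y = c * q)) :=
      fun y => by rw [mem_oflipCM_iff', hΦmem, mem_orb]
    have hmemg : ∀ y : G, y ∈ (oflipCM c hc2 g₁ Φ).1 ↔ ¬ (π y ∈ ({r 0, r 3, sr 1, sr 2} : Finset (DihedralGroup 4)) ↔ (y = g₁ ∨ y = c * g₁)) :=
      fun y => by rw [mem_oflipCM_iff', hΦmem, mem_orb]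
    have hE : ∀ P : G, P * g ∈ (oflipCM c hc2 q Φ).1 ↔ P ∈ (oflipCM c hc2 g₁ Φ).1 := fun P => by rw [← mem_rt (c := c) g, E]
    -- `π`-separation of elements
    have hπne : ∀ {x y : G} (dx dy : DihedralGroup 4), π x = dx → π y = dy → dx ≠ dy → x ≠ y :=
      fun dx dy hx hy hd e => hd (hx.symm.trans ((congrArg π e).trans hy))
    have hπcq : π (c * q) = sr 2 := by rw [map_mul, hπc, hπq]; decide
    have hπcg₁ : π (c * g₁) = sr 3 := by rw [map_mul, hπc, hπg₁]; decide
    have hπqz : π (q * z) = sr 0 := by rw [map_mul, hπq, hπz, mul_one]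
    have hπg₁z : π (g₁ * z) = sr 1 := by rw [map_mul, hπg₁, hπz, mul_one]
    -- `q·g⁻¹ ∈ Φ^{(g₁)}` and `q·z·g⁻¹ ∉ Φ^{(g₁)}`
    have h1 : q * g⁻¹ ∈ (oflipCM c hc2 g₁ Φ).1 := by
      rw [← hE, inv_mul_cancel_right, hmemq, hπq]
      intro h; exact absurd (h.mpr (Or.inl rfl)) (by decide)
    have h2 : q * g⁻¹ * z ∉ (oflipCM c hc2 g₁ Φ).1 := by
      rw [show q * g⁻¹ * z = q * z * g⁻¹ by rw [mul_assoc, mul_assoc, hzc g⁻¹], ← hE, inv_mul_cancel_right, hmemq, hπqz, not_not]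
      constructor
      · intro h; exact absurd h (by decide)
      · rintro (h | h)
        · exact absurd h (hne_z q).symm
        · exact absurd h (hπne (sr 0) (sr 2) hπqz hπcq (by decide))
    -- hence `q·g⁻¹ ∈ {g₁z, c·g₁}`
    have h3 : q * g⁻¹ = g₁ * z ∨ q * g⁻¹ = c * g₁ := by
      have hy := (hmemg (q * g⁻¹)).mp h1
      have hyz : π (q * g⁻¹ * z) ∈ ({r 0, r 3, sr 1, sr 2} : Finset (DihedralGroup 4)) ↔ (q * g⁻¹ * z = g₁ ∨ q * g⁻¹ * z = c * g₁) := by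
        have h := h2; rw [hmemg, not_not] at h; exact h
      rw [map_mul, hπz, mul_one] at hyz
      by_cases hπy : π (q * g⁻¹) ∈ ({r 0, r 3, sr 1, sr 2} : Finset (DihedralGroup 4))
      · rcases hyz.mp hπy with e | e
        · left; rw [← e, mul_assoc, hz2, mul_one]
        · exfalso
          have e2 : π (q * g⁻¹) = sr 3 := by
            have e3 : q * g⁻¹ = c * g₁ * z := by rw [← e, mul_assoc, hz2, mul_one]
            rw [e3, map_mul, hπcg₁, hπz, mul_one]
          rw [e2] at hπy; exact absurd hπy (by decide)
      · have hor : q * g⁻¹ = g₁ ∨ q * g⁻¹ = c * g₁ := by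
          by_contra hn'; exact hy (iff_of_false hπy hn')
        rcases hor with e | e
        · exfalso; rw [e, hπg₁] at hπy; exact hπy (by decide)
        · exact Or.inr e
    rcases h3 with h3 | h3
    · -- `π g = r³`: the element `ρ` separates
      have hπg : π g = r 3 := by
        have e := congrArg π h3
        rw [map_mul, map_inv, hπq, hπg₁z] at e
        have e2 : (π g)⁻¹ = (sr 0)⁻¹ * sr 1 := eq_inv_mul_of_mul_eq e
        rw [← inv_inv (π g), e2]; decide
      have hρg : ρ * g ∈ (oflipCM c hc2 q Φ).1 := by
        rw [hmemq, map_mul, hρ, hπg]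
        intro h
        have hρg' : π (ρ * g) = r 0 := by rw [map_mul, hρ, hπg]; decide
        rcases h.mp (by decide) with e | e
        · exact hπne (r 0) (sr 0) hρg' hπq (by decide) e
        · exact hπne (r 0) (sr 2) hρg' hπcq (by decide) e
      have hρn : ρ ∉ (oflipCM c hc2 g₁ Φ).1 := by
        rw [hmemg, hρ, not_not]
        constructor
        · intro h; exact absurd h (by decide)
        · rintro (e | e)
          · exact absurd e (hπne (r 1) (sr 1) hρ hπg₁ (by decide))
          · exact absurd e (hπne (r 1) (sr 3) hρ hπcg₁ (by decide))
      exact hρn ((hE ρ).mp hρg)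
    · -- `π g = r`: the element `1` separates
      have hπg : π g = r 1 := by
        have e := congrArg π h3
        rw [map_mul, map_inv, hπq, hπcg₁] at e
        have e2 : (π g)⁻¹ = (sr 0)⁻¹ * sr 3 := eq_inv_mul_of_mul_eq e
        rw [← inv_inv (π g), e2]; decide
      have h1g : (1 : G) * g ∉ (oflipCM c hc2 q Φ).1 := by
        rw [one_mul, hmemq, hπg, not_not]
        constructor
        · intro h; exact absurd h (by decide)
        · rintro (e | e)
          · exact absurd e (hπne (r 1) (sr 0) hπg hπq (by decide))
          · exact absurd e (hπne (r 1) (sr 2) hπg hπcq (by decide))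
      have h1m : (1 : G) ∈ (oflipCM c hc2 g₁ Φ).1 := by
        rw [hmemg, map_one]
        intro h
        rcases h.mp (by decide) with e | e
        · exact hπne (r 0) (sr 1) (map_one π) hπg₁ (by decide) e
        · exact hπne (r 0) (sr 3) (map_one π) hπcg₁ (by decide) e
      exact h1g ((hE 1).mpr h1m)
  -- the frame law
  exact isLeast_card_gfaces_generate_order_four c hc2 hcen T₀ T₁ hbase 2 hn hH hG hc1 rfl q rfl hQ₁ hσH {ρ, ρ * z} {q, q * z} hTH hA hT hAtr
    rfl (hne_z ρ) Φ hΦ rfl (hne_z q) hHe (hne_z g₁) g₁ hg₁T₀ hg₁T₁ hgΦ hAce (by rw [mul_inv_cancel]; exact hz1.symm) ha₁A ha₂A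
    (hne_z q).symm hζh hζκ hσh hσh'' hσκ₁ hσκ₂ hB

end

end Summit.HodgeConjecture.CorCM.Census.CentralSquares
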